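import Summits.CriticalPhenomena.PercolationContinuityZ3.Theorems.PercNearOneGluingNoHeavyLowerTailThreePointProductFormFibreParallelWalks
import HarnessLib

/-!
# The series piece: a pendant apex label over a sub-instance (Sahi programme, prover prim-sahi-p2 gen 59)

Support file (`--supports stmt-CriticalPhenomena-4575`, helper).  Standard axioms, no sorries, no named facts, no definitions.
Memo `run/shared/lean/prim/prim-sahi/FROM-prim-sahi-p2-gen59-ONE-STEP-LEMMA.md` §2, §8(2); `prim-sahi-p2/PROOF-E3.md` (68j), §69.

SETTING.  A SERIES PIECE for the terminals `(s, a, c)` is a label class `Q = {e} ∪ Qᵤ` where `e` is a label `a — u` (`u ∉ {s,a,c}`) and the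
labels of `Qᵤ` avoid `a` (the sub-instance at `u`, read with terminals `(s, u, c)`).  For a configuration `y` supported on `Q`:
* `reachable_series` — between vertices other than `a`, `y`-connection = connection in `y|_{Qᵤ}`; `a` is joined to `q ≠ a` iff `e` is open
  and `u` is joined to `q` in `y|_{Qᵤ}` (the apex hangs on the pendant label `e`);
* `flat_series_apply` — the flat at `a` of `x = z|_Q`, restricted to `Q`: `e ↦ ¬ z e`; on `Qᵤ` it is the flat at `u` of `z|_{Qᵤ}` if `e` is open
  in `z`, and `z|_{Qᵤ}` itself if `e` is closed;
* `two_mul_card_series_*` — hence the SIX statistics of the piece (part III of the parallel-composition files) are, with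
  `(r, p, q) = (#S0, #isoC, #isoS)` of the sub-instance `(Qᵤ; s, u, c)` and `g = #good = #{S0 ∧ s ↮ c in its restricted flat}`:
  `2·#S0 = p + q`, `2·#isoC = 2p + q − r`, `2·#isoS = p + 2q − r`, `2·Ga = p + g`, `2·Gb = q + g`, `2·G1 = r + g`
  — the per-child factors of the gen-58 tree recursion (68j) (`…ThreePointProductFormTreeRecursion`).
[this work] (gen 59).
-/

namespace Summit.CriticalPhenomena.PercolationContinuityZ3.Theorems.ProductFormFibre

open Finset Literature.Probability.Percolation
open Summit.CriticalPhenomena.PercolationContinuityZ3.Theorems.ThreePointCPIClusterSwap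
  (QTouch clusterFlip clusterFlip_of_qtouch clusterFlip_of_not_qtouch)

variable {V α : Type*}

section Series

variable [DecidableEq α] (ends : α → Sym2 V) (a u : V) (e : α) (Qu : α → Prop) [DecidablePred Qu]
  (he : ends e = s(a, u)) (hua : u ≠ a) (hQu : ∀ l, Qu l → ∀ v ∈ ends l, v ≠ a) (heQ : ¬ Qu e)

omit [DecidableEq α] in
include he hua hQu heQ in
/-- **Connections in a series piece.**  For `y` supported on `{e} ∪ Qᵤ`: a walk between non-apex vertices is a walk of `y|_{Qᵤ}`, and a walk
from `a` to `q ≠ a` starts with the open label `e` and continues in `y|_{Qᵤ}` from `u`. [this work] -/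
theorem reachable_series_aux (y : α → Bool) (hy : ∀ l, y l = true → l = e ∨ Qu l) :
    ∀ {p q : V} (w : (openGraph (labelledOpen ends y)).Walk p q),
      (p ≠ a → q ≠ a → (openGraph (labelledOpen ends fun l => y l && decide (Qu l))).Reachable p q) ∧
      (p = a → q ≠ a → y e = true ∧ (openGraph (labelledOpen ends fun l => y l && decide (Qu l))).Reachable u q)
  | p, _, .nil => ⟨fun _ _ => SimpleGraph.Reachable.refl _, fun hp hq => absurd hp hq⟩
  | p, q, .cons (v := v) h w => by
      have h' := h
      rw [openGraph_adj] at h'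
      obtain ⟨⟨l, hl, hlv⟩, hne⟩ := h'
      obtain ⟨IH1, IH2⟩ := reachable_series_aux y hy w
      -- if the label is `e`, its endpoints are `{a, u}`
      have hcase : l = e → (p = a ∧ v = u) ∨ (p = u ∧ v = a) := by
        intro hle; subst hle
        rw [he] at hlv
        rcases Sym2.eq_iff.mp hlv with ⟨h1, h2⟩ | ⟨h1, h2⟩
        · exact Or.inl ⟨h1.symm, h2.symm⟩
        · exact Or.inr ⟨h2.symm, h1.symm⟩
      constructor
      · intro hp hq
        -- `l ≠ e` would force `p = a` or `v = a`
        by_cases hva : v = a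
        · -- then `l = e`, `p = u`, and the rest of the walk starts at `a`
          have hle : l = e := by
            rcases hy l hl with h1 | h1
            · exact h1
            · exact absurd hva (hQu l h1 v (by rw [hlv]; exact Sym2.mem_mk_right p v))
          rcases hcase hle with ⟨h1, _⟩ | ⟨h1, _⟩
          · exact absurd h1 hp
          · obtain ⟨-, hr⟩ := IH2 hva hq
            rw [h1]; exact hr
        · have hQ : Qu l := by
            rcases hy l hl with h1 | h1
            · rcases hcase h1 with ⟨h2, _⟩ | ⟨_, h2⟩
              · exact absurd h2 hp
              · exact absurd h2 hva
            · exact h1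
          have hpv : (openGraph (labelledOpen ends fun l => y l && decide (Qu l))).Reachable p v := by
            refine SimpleGraph.Adj.reachable ?_
            rw [openGraph_adj]
            exact ⟨⟨l, by simp [hl, hQ], hlv⟩, hne⟩
          exact hpv.trans (IH1 hva hq)
      · intro hp hq
        rw [hp] at hlv
        have hle : l = e := by
          rcases hy l hl with h1 | h1
          · exact h1
          · exact absurd rfl (hQu l h1 a (by rw [hlv]; exact Sym2.mem_mk_left a v))
        have hv : v = u := by
          rcases hcase hle with ⟨_, h2⟩ | ⟨h1, _⟩
          · exact h2
          · exact absurd (h1.symm.trans hp) hua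
        have hva : v ≠ a := by rw [hv]; exact hua
        refine ⟨hle ▸ hl, ?_⟩
        rw [← hv]
        exact IH1 hva hq

omit [DecidableEq α] in
include he hua hQu heQ in
/-- Connections between non-apex vertices of a series piece live in the sub-instance. [this work] -/
theorem reachable_series_iff (y : α → Bool) (hy : ∀ l, y l = true → l = e ∨ Qu l) {p q : V} (hp : p ≠ a) (hq : q ≠ a) :
    (openGraph (labelledOpen ends y)).Reachable p q ↔
      (openGraph (labelledOpen ends fun l => y l && decide (Qu l))).Reachable p q := by
  constructor
  · rintro ⟨w⟩
    exact (reachable_series_aux ends a u e Qu he hua hQu heQ y hy w).1 hp hq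
  · rintro ⟨w⟩
    exact reachable_of_walk_of_labels ends _ y w fun l hl _ => by
      simp only [Bool.and_eq_true] at hl; exact hl.1

omit [DecidableEq α] in
include he hua hQu heQ in
/-- The apex of a series piece is joined to `q ≠ a` iff `e` is open and `u` is joined to `q` in the sub-instance. [this work] -/
theorem reachable_apex_series_iff (y : α → Bool) (hy : ∀ l, y l = true → l = e ∨ Qu l) {q : V} (hq : q ≠ a) :
    (openGraph (labelledOpen ends y)).Reachable a q ↔
      y e = true ∧ (openGraph (labelledOpen ends fun l => y l && decide (Qu l))).Reachable u q := by
  constructor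
  · rintro ⟨w⟩
    exact (reachable_series_aux ends a u e Qu he hua hQu heQ y hy w).2 rfl hq
  · rintro ⟨hye, ⟨w⟩⟩
    have hau : (openGraph (labelledOpen ends y)).Reachable a u := by
      refine SimpleGraph.Adj.reachable ?_
      rw [openGraph_adj]
      exact ⟨⟨e, hye, he⟩, hua.symm⟩
    exact hau.trans (reachable_of_walk_of_labels ends _ y w fun l hl _ => by
      simp only [Bool.and_eq_true] at hl; exact hl.1)

include he hua hQu heQ in
/-- **The flat of a series piece.**  For `x = z|_{{e} ∪ Qᵤ}` and a label `l ∈ Qᵤ`: the flat at `a` flips `l` iff `e` is open and the flat at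
`u` of `z|_{Qᵤ}` flips `l`; so on `Qᵤ` the flat of the piece is the flat of the sub-instance (`e` open) or the identity (`e` closed). [this work] -/
theorem flat_series_apply [DecidableEq V] (z : α → Bool) {l : α} (hl : Qu l) :
    clusterFlip ends a (fun y => !(z y && decide (y = e ∨ Qu y))) l =
      if z e = true then clusterFlip ends u (fun y => !(z y && decide (Qu y))) l else z l := by
  classical
  set x : α → Bool := fun y => z y && decide (y = e ∨ Qu y) with hx
  have hxsupp : ∀ l, x l = true → l = e ∨ Qu l := fun l h => by
    simp only [hx, Bool.and_eq_true, decide_eq_true_eq] at h; exact h.2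
  have hxu : (fun y => x y && decide (Qu y)) = fun y => z y && decide (Qu y) := by
    funext y; simp only [hx]; by_cases h : Qu y <;> simp [h]
  have hxl : x l = z l := by simp [hx, hl]
  -- touching the apex cluster
  have htouch : QTouch ends a (fun y => !x y) l ↔
      z e = true ∧ QTouch ends u (fun y => !(z y && decide (Qu y))) l := by
    rw [qtouch_compl_iff, qtouch_compl_iff]
    constructor
    · rintro ⟨v, hv, hr⟩
      have hva : v ≠ a := hQu l hl v hv
      obtain ⟨hxe, hr'⟩ := (reachable_apex_series_iff ends a u e Qu he hua hQu heQ x hxsupp hva).1 hr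
      rw [hxu] at hr'
      exact ⟨by simpa [hx] using hxe, v, hv, hr'⟩
    · rintro ⟨hze, v, hv, hr⟩
      have hva : v ≠ a := hQu l hl v hv
      refine ⟨v, hv, (reachable_apex_series_iff ends a u e Qu he hua hQu heQ x hxsupp hva).2 ⟨by simp [hx, hze], ?_⟩⟩
      rw [hxu]; exact hr
  by_cases hze : z e = true
  · rw [if_pos hze]
    by_cases ht : QTouch ends u (fun y => !(z y && decide (Qu y))) l
    · rw [clusterFlip_of_qtouch ends a _ (htouch.2 ⟨hze, ht⟩), clusterFlip_of_qtouch ends u _ ht]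
      simp [hxl, hl]
    · rw [clusterFlip_of_not_qtouch ends a _ (fun h => ht (htouch.1 h).2), clusterFlip_of_not_qtouch ends u _ ht]
      simp [hxl, hl]
  · rw [if_neg hze]
    rw [clusterFlip_of_not_qtouch ends a _ (fun h => hze (htouch.1 h).1)]
    simp [hxl]

include he in
/-- The flat of a series piece complements the pendant apex label. [this work] -/
theorem flat_series_apex [DecidableEq V] (z : α → Bool) :
    clusterFlip ends a (fun y => !(z y && decide (y = e ∨ Qu y))) e = !(z e) := by
  classical
  have ht : QTouch ends a (fun y => !(z y && decide (y = e ∨ Qu y))) e := by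
    rw [qtouch_compl_iff]
    exact ⟨a, by rw [he]; exact Sym2.mem_mk_left a u, SimpleGraph.Reachable.refl _⟩
  rw [clusterFlip_of_qtouch ends a _ ht]
  simp

end Series

end Summit.CriticalPhenomena.PercolationContinuityZ3.Theorems.ProductFormFibre
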